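import Mathlib.RingTheory.Localization.NumDen
import Mathlib.RingTheory.Localization.AtPrime.Basic
import Mathlib.RingTheory.UniqueFactorizationDomain.Multiplicity
import Mathlib.RingTheory.Polynomial.UniqueFactorization
import Mathlib.RingTheory.Polynomial.Basic
import Mathlib.Tactic.FieldSimp
import Mathlib.Tactic.Ring
import HarnessLib

/-!
# Units at a prime of a factorial domain, read in the fraction field

Elementary bookkeeping in the fraction field `L` of a domain `T` for the local rings `T_𝔮` at
prime ideals `𝔮 ⊂ T`, tailored to the divisor calculus of `Literature/AlgebraicGeometry/Motives`
(a rational function is a unit at a point `z` of an affine chart `Spec T` iff it is a quotient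
`c/d` of sections `c, d ∉ 𝔭_z`; `Motives/RatFnAffine`). For a factorial `T`
(Görtz–Wedhorn I, Prop. B.73 (3) and Prop. B.75: in a factorial domain the prime ideals of
height one are the `(p)`, `p` a prime element, and `T = ⋂ T_(p)`):

* `unitsAt L 𝔮` — the submonoid `T_𝔮^× ⊆ L` of fractions `c/d` with `c, d ∉ 𝔮`; monotone in
  `𝔮`, a group (`inv_mem_unitsAt`), and unchanged under localisation
  (`unitsAt_comap_eq`: for `T'` a localisation of `T` and a prime `𝔮' ⊂ T'`,
  `T_{𝔮' ∩ T}^× = T'_{𝔮'}^×` inside `L`);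
* `mem_unitsAt_of_forall_prime` — **the local form of "`T = ⋂ T_(p)`"**: if `r ∈ L^×` lies in
  `T_(p)^×` for every prime element `p ∈ 𝔮`, then `r ∈ T_𝔮^×` (write `r = a/b` in lowest terms;
  a prime factor of `a` or `b` inside `𝔮` would contradict `r ∈ T_(p)^×`);
* `exists_zpow_mem_unitsAt` — every `r ∈ L^×` is `p^e · u` with `u ∈ T_(p)^×` (`e ∈ ℤ`, the
  `p`-adic valuation of `r`; only its existence is recorded);
* `algebraMap_mem_unitsAt_span_iff` — `a ∈ T_(p)^×` iff `p ∤ a`;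
* `prod_zpow_div_mem_unitsAt`, `prod_zpow_mem_unitsAt_of_forall_not_associated` — for a finite
  set `Q` of pairwise non-associated primes and exponents `c`, the product `ψ = ∏_{q ∈ Q} q^{c_q}`
  is `q₀^{c_{q₀}}` times a unit of `T_(q₀)` for `q₀ ∈ Q`, and a unit of `T_(ϖ)` for every prime
  `ϖ` associated to no member of `Q`;
* `exists_finset_primes_of_ne_zero` — the prime divisors of `a ≠ 0`, as a finite set of pairwise
  non-associated primes;
* `MvPolynomial.exists_prime_associated_C_of_dvd_C`, `MvPolynomial.comap_C_span_eq_bot_or` — **the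
  prime elements of `R[t₁, …, tₙ]` over a factorial `R`** are either "horizontal"
  (`(ϖ) ∩ R = 0`) or associated to a prime constant `π ∈ R` (unique factorisation of a nonzero
  constant multiple of `ϖ` into the primes `C π` of `R[t]`, Mathlib `MvPolynomial.prime_C_iff`).

These are the ring-theoretic steps of the proof that Cartier divisors on `𝔸ⁿ_X`, `X` locally
factorial, come from `X` up to principal divisors (Görtz–Wedhorn II, Prop. 27.69 / Lemma 27.70 in
divisor form; `Motives/AffineSpaceDivisor*`). Everything is proved; no named facts.

Mathlib searched (pin v4.32.0) and used: `IsFractionRing.exists_reduced_fraction` /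
`IsFractionRing.mk'_eq_div` (`Localization/NumDen`), `IsRelPrime`, `FiniteMultiplicity`,
`UniqueFactorizationMonoid.factors` / `factors_prod` / `prime_of_factor` /
`exists_mem_factors_of_dvd`, `Associates.mk_eq_mk_iff_associated`, `Prime.associated_of_dvd`,
`MvPolynomial.prime_C_iff`, `MvPolynomial.uniqueFactorizationMonoid`, `IsLocalization.surj`,
`IsLocalization.map_units`; Mathlib has the valuation of a DVR and `multiplicity`, but no
"units at a prime inside the fraction field" bookkeeping of this kind.

## References

* U. Görtz, T. Wedhorn, *Algebraic Geometry I: Schemes*, 2nd ed., Springer Spektrum (2020),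
  doi:10.1007/978-3-658-30733-2: Prop. B.73 (3), Prop./Def. B.74, Prop. B.75 (p. 571).
  [GortzWedhorn2020]
* H. Matsumura, *Commutative Ring Theory*, Cambridge (1987): Thm. 11.5, Thm. 20.1.
  [Matsumura1987]
-/

open Ideal

namespace Literature.RingTheory.UniqueFactorizationDomain

variable {T : Type*} [CommRing T] (L : Type*) [Field L] [Algebra T L]

/-! ### The units of `T_𝔮` inside the fraction field -/

/-- **The units of the local ring `T_𝔮` read inside `L ⊇ T`**: the fractions `c/d` with
`c, d ∉ 𝔮` (Görtz–Wedhorn I, (B.5): `T_𝔮 = {a/s ; s ∉ 𝔮}`, whose units are the `a/s` with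
`a ∉ 𝔮`). Recorded as a submonoid of `L`; membership is `r * d = c` to avoid division.
[folklore] -/
def unitsAt (𝔮 : Ideal T) [𝔮.IsPrime] : Submonoid L where
  carrier := {r | ∃ c d : T, c ∉ 𝔮 ∧ d ∉ 𝔮 ∧ r * algebraMap T L d = algebraMap T L c}
  one_mem' := ⟨1, 1, (Ideal.ne_top_iff_one 𝔮).1 IsPrime.ne_top',
    (Ideal.ne_top_iff_one 𝔮).1 IsPrime.ne_top', by simp⟩
  mul_mem' := by
    rintro r s ⟨c, d, hc, hd, hr⟩ ⟨c', d', hc', hd', hs⟩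
    refine ⟨c * c', d * d', fun h => ((IsPrime.mem_or_mem ‹𝔮.IsPrime› h).elim hc hc'),
      fun h => ((IsPrime.mem_or_mem ‹𝔮.IsPrime› h).elim hd hd'), ?_⟩
    rw [map_mul, map_mul, ← hr, ← hs]; ring

variable {L}

section Basic

variable {𝔮 : Ideal T} [𝔮.IsPrime]

/-- Membership in `unitsAt`, unfolded. [folklore] -/
theorem mem_unitsAt_iff {r : L} :
    r ∈ unitsAt L 𝔮 ↔ ∃ c d : T, c ∉ 𝔮 ∧ d ∉ 𝔮 ∧ r * algebraMap T L d = algebraMap T L c :=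
  Iff.rfl

/-- `unitsAt` is antitone in the prime: `T_{𝔮'}^× ⊆ T_𝔮^×` for `𝔮 ⊆ 𝔮'`. [folklore] -/
theorem unitsAt_mono {𝔮' : Ideal T} [𝔮'.IsPrime] (h : 𝔮 ≤ 𝔮') : unitsAt L 𝔮' ≤ unitsAt L 𝔮 :=
  fun _ ⟨c, d, hc, hd, e⟩ => ⟨c, d, fun h' => hc (h h'), fun h' => hd (h h'), e⟩

variable (hinj : Function.Injective (algebraMap T L))
include hinj

/-- A unit of `T_𝔮` is nonzero (for `T ⊆ L`). [folklore] -/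
theorem ne_zero_of_mem_unitsAt {r : L} (hr : r ∈ unitsAt L 𝔮) : r ≠ 0 := by
  rintro rfl
  obtain ⟨c, d, hc, -, e⟩ := hr
  rw [zero_mul, eq_comm, map_eq_zero_iff _ hinj] at e
  exact hc (e ▸ 𝔮.zero_mem)

/-- **An element `a ∈ T` is a unit of `T_𝔮` iff `a ∉ 𝔮`.** [folklore] -/
theorem algebraMap_mem_unitsAt_iff {a : T} : algebraMap T L a ∈ unitsAt L 𝔮 ↔ a ∉ 𝔮 := by
  constructor
  · rintro ⟨c, d, hc, hd, e⟩ ha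
    rw [← map_mul] at e
    exact hc (hinj e ▸ 𝔮.mul_mem_right d ha)
  · intro ha
    exact ⟨a, 1, ha, (Ideal.ne_top_iff_one 𝔮).1 IsPrime.ne_top', by simp⟩

/-- `unitsAt` is closed under inverses (it is the unit group of `T_𝔮`). [folklore] -/
theorem inv_mem_unitsAt {r : L} (hr : r ∈ unitsAt L 𝔮) : r⁻¹ ∈ unitsAt L 𝔮 := by
  have hr0 := ne_zero_of_mem_unitsAt hinj hr
  obtain ⟨c, d, hc, hd, e⟩ := hr
  refine ⟨d, c, hd, hc, ?_⟩
  have hc0 : algebraMap T L c ≠ 0 := fun h => hc ((map_eq_zero_iff _ hinj).1 h ▸ 𝔮.zero_mem)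
  rw [← e, ← mul_assoc, inv_mul_cancel₀ hr0, one_mul]

/-- `unitsAt` is closed under quotients. [folklore] -/
theorem div_mem_unitsAt {r s : L} (hr : r ∈ unitsAt L 𝔮) (hs : s ∈ unitsAt L 𝔮) :
    r / s ∈ unitsAt L 𝔮 := by
  rw [div_eq_mul_inv]; exact mul_mem hr (inv_mem_unitsAt hinj hs)

/-- `unitsAt` is closed under integer powers. [folklore] -/
theorem zpow_mem_unitsAt {r : L} (hr : r ∈ unitsAt L 𝔮) (e : ℤ) : r ^ e ∈ unitsAt L 𝔮 := by
  cases e with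
  | ofNat n => rw [Int.ofNat_eq_natCast, zpow_natCast]; exact pow_mem hr n
  | negSucc n => rw [zpow_negSucc]; exact inv_mem_unitsAt hinj (pow_mem hr _)

/-- Membership in `unitsAt` only depends on the class modulo units: if `r ∈ T_𝔮^×` then
`s ∈ T_𝔮^× ↔ s * r ∈ T_𝔮^×`. [folklore] -/
theorem mul_mem_unitsAt_iff_left {r s : L} (hr : r ∈ unitsAt L 𝔮) :
    s * r ∈ unitsAt L 𝔮 ↔ s ∈ unitsAt L 𝔮 := by
  refine ⟨fun h => ?_, fun h => mul_mem h hr⟩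
  have := mul_mem h (inv_mem_unitsAt hinj hr)
  rwa [mul_assoc, mul_inv_cancel₀ (ne_zero_of_mem_unitsAt hinj hr), mul_one] at this

end Basic

/-! ### Invariance under localisation -/

section Localization

variable {T' : Type*} [CommRing T'] [Algebra T T'] [Algebra T' L] [IsScalarTower T T' L]

/-- **`T_{𝔮' ∩ T}^× = T'_{𝔮'}^×` inside `L`** for a localisation `T'` of `T` and a prime
`𝔮' ⊂ T'` (the local rings agree: `T_{𝔮' ∩ T} = T'_{𝔮'}`, Görtz–Wedhorn I, (B.5)). The
elements of `M` are units of `T'`, hence automatically outside `𝔮' ∩ T`. [folklore] -/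
theorem unitsAt_comap_eq (M : Submonoid T) [IsLocalization M T'] (𝔮' : Ideal T') [𝔮'.IsPrime] :
    haveI : (𝔮'.comap (algebraMap T T')).IsPrime := Ideal.IsPrime.comap _
    unitsAt L (𝔮'.comap (algebraMap T T')) = unitsAt L 𝔮' := by
  haveI : (𝔮'.comap (algebraMap T T')).IsPrime := Ideal.IsPrime.comap _
  have hM : ∀ m : M, algebraMap T T' m ∉ 𝔮' := fun m hm =>
    IsPrime.ne_top' (𝔮'.eq_top_of_isUnit_mem hm (IsLocalization.map_units T' m))
  ext r
  constructor
  · rintro ⟨c, d, hc, hd, e⟩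
    refine ⟨algebraMap T T' c, algebraMap T T' d, hc, hd, ?_⟩
    rwa [← IsScalarTower.algebraMap_apply, ← IsScalarTower.algebraMap_apply]
  · rintro ⟨c', d', hc', hd', e⟩
    obtain ⟨⟨c, m⟩, hc⟩ := IsLocalization.surj M c'
    obtain ⟨⟨d, m'⟩, hd⟩ := IsLocalization.surj M d'
    simp only at hc hd
    refine ⟨c * m', d * m, ?_, ?_, ?_⟩
    · intro h
      rw [Ideal.mem_comap, map_mul, ← hc] at h
      rcases IsPrime.mem_or_mem ‹𝔮'.IsPrime› h with h | h
      · exact (IsPrime.mem_or_mem ‹𝔮'.IsPrime› h).elim hc' (hM m)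
      · exact hM m' h
    · intro h
      rw [Ideal.mem_comap, map_mul, ← hd] at h
      rcases IsPrime.mem_or_mem ‹𝔮'.IsPrime› h with h | h
      · exact (IsPrime.mem_or_mem ‹𝔮'.IsPrime› h).elim hd' (hM m')
      · exact hM m h
    · have e1 : algebraMap T L (d * m) = algebraMap T' L d' * algebraMap T L m * algebraMap T L m' := by
        rw [IsScalarTower.algebraMap_apply T T' L, map_mul, ← hd, map_mul, map_mul,
          ← IsScalarTower.algebraMap_apply, ← IsScalarTower.algebraMap_apply]
        ring
      have e2 : algebraMap T L (c * m') = algebraMap T' L c' * algebraMap T L m * algebraMap T L m' := by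
        rw [IsScalarTower.algebraMap_apply T T' L, map_mul, ← hc, map_mul, map_mul,
          ← IsScalarTower.algebraMap_apply, ← IsScalarTower.algebraMap_apply]
      rw [e1, e2, ← e]
      ring

end Localization

/-! ### Factorial domains: units at `𝔮` from units at the primes `(p) ⊆ 𝔮` -/

section Span

variable [IsDomain T] [IsFractionRing T L]

omit [IsDomain T] in
/-- **`a ∈ T` is a unit of `T_(p)` iff `p ∤ a`**, for a prime element `p`. [folklore] -/
theorem algebraMap_mem_unitsAt_span_iff {p : T} (hp : Prime p) {a : T} :
    haveI := (Ideal.span_singleton_prime hp.ne_zero).2 hp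
    algebraMap T L a ∈ unitsAt L (Ideal.span {p}) ↔ ¬ p ∣ a := by
  haveI := (Ideal.span_singleton_prime hp.ne_zero).2 hp
  rw [algebraMap_mem_unitsAt_iff (IsFractionRing.injective T L), Ideal.mem_span_singleton]

/-- A prime `p'` not associated to the prime `p` is a unit of `T_(p)`. [folklore] -/
theorem algebraMap_mem_unitsAt_span_of_not_associated {p p' : T} (hp : Prime p) (hp' : Prime p')
    (h : ¬ Associated p p') :
    haveI := (Ideal.span_singleton_prime hp.ne_zero).2 hp
    algebraMap T L p' ∈ unitsAt L (Ideal.span {p}) :=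
  (algebraMap_mem_unitsAt_span_iff hp).2 fun hd => h (hp.associated_of_dvd hp' hd)

omit [IsDomain T] in
/-- The prime `p` itself is not a unit of `T_(p)`. [folklore] -/
theorem algebraMap_not_mem_unitsAt_span {p : T} (hp : Prime p) :
    haveI := (Ideal.span_singleton_prime hp.ne_zero).2 hp
    algebraMap T L p ∉ unitsAt L (Ideal.span {p}) := fun h =>
  (algebraMap_mem_unitsAt_span_iff hp).1 h (dvd_refl p)

end Span

section UFD

variable [IsDomain T] [UniqueFactorizationMonoid T] [IsFractionRing T L]

omit [IsDomain T] [IsFractionRing T L] in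
/-- In a prime ideal `𝔮` of a factorial domain, every nonzero element has a prime factor in `𝔮`
(factor it; a prime ideal containing a product contains a factor). [folklore] -/
theorem exists_prime_dvd_mem {𝔮 : Ideal T} [𝔮.IsPrime] {a : T} (ha0 : a ≠ 0) (ha : a ∈ 𝔮) :
    ∃ p : T, Prime p ∧ p ∣ a ∧ p ∈ 𝔮 := by
  classical
  obtain ⟨u, hu⟩ := UniqueFactorizationMonoid.factors_prod ha0
  have hprod : (UniqueFactorizationMonoid.factors a).prod ∈ 𝔮 := by
    rw [← hu] at ha
    exact ((IsPrime.mem_or_mem ‹𝔮.IsPrime› ha).resolve_right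
      fun h => IsPrime.ne_top' (𝔮.eq_top_of_isUnit_mem h u.isUnit))
  obtain ⟨p, hp, hp𝔮⟩ := (IsPrime.multiset_prod_mem_iff_exists_mem ‹𝔮.IsPrime› _).1 hprod
  exact ⟨p, UniqueFactorizationMonoid.prime_of_factor p hp,
    (Multiset.dvd_prod hp).trans (Dvd.intro _ hu), hp𝔮⟩

/-- **The local form of `T = ⋂_p T_(p)` (Görtz–Wedhorn I, Prop. B.73 (3) for the factorial — hence
normal — domain `T`): if `r ∈ L^×` is a unit of `T_(p)` for every prime element `p ∈ 𝔮`, then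
`r` is a unit of `T_𝔮`.** Write `r = a/b` in lowest terms (Mathlib
`IsFractionRing.exists_reduced_fraction`); if `a ∈ 𝔮`, a prime factor `p ∈ 𝔮` of `a` divides
`b c = a d` for a presentation `r = c/d` over `T_(p)`, hence divides `b` — contradicting
coprimality; likewise for `b`. [cite: GortzWedhorn2020, Prop. B.73 (3) (p. 571)] -/
theorem mem_unitsAt_of_forall_prime {𝔮 : Ideal T} [𝔮.IsPrime] {r : L} (hr : r ≠ 0)
    (h : ∀ (p : T) (hp : Prime p), p ∈ 𝔮 →
      haveI := (Ideal.span_singleton_prime hp.ne_zero).2 hp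
      r ∈ unitsAt L (Ideal.span {p})) :
    r ∈ unitsAt L 𝔮 := by
  have hinj := IsFractionRing.injective T L
  obtain ⟨a, b, hab, e⟩ := IsFractionRing.exists_reduced_fraction (A := T) r
  have hb0 : (b : T) ≠ 0 := nonZeroDivisors.ne_zero b.2
  have ha0 : a ≠ 0 := by
    rintro rfl
    rw [IsLocalization.mk'_zero] at e
    exact hr e.symm
  have er : r * algebraMap T L b = algebraMap T L a := by
    rw [← e, IsLocalization.mk'_spec]
  -- for a prime `p ∈ 𝔮`: `p ∤ a` and `p ∤ b`
  have key : ∀ p : T, Prime p → p ∈ 𝔮 → ¬ p ∣ a ∧ ¬ p ∣ (b : T) := by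
    intro p hp hp𝔮
    haveI := (Ideal.span_singleton_prime hp.ne_zero).2 hp
    obtain ⟨c, d, hc, hd, ecd⟩ := h p hp hp𝔮
    rw [Ideal.mem_span_singleton] at hc hd
    -- `a d = b c`
    have had : a * d = b * c := hinj (by
      rw [map_mul, map_mul, ← er, ← ecd]; ring)
    constructor
    · intro hpa
      have : p ∣ (b : T) * c := had ▸ dvd_mul_of_dvd_left hpa d
      rcases hp.dvd_or_dvd this with h' | h'
      · exact hp.not_unit (hab (hpa) h')
      · exact hc h'
    · intro hpb
      have : p ∣ a * d := had ▸ dvd_mul_of_dvd_left hpb c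
      rcases hp.dvd_or_dvd this with h' | h'
      · exact hp.not_unit (hab h' hpb)
      · exact hd h'
  refine ⟨a, b, fun ha => ?_, fun hb => ?_, er⟩
  · obtain ⟨p, hp, hpa, hp𝔮⟩ := exists_prime_dvd_mem ha0 ha
    exact (key p hp hp𝔮).1 hpa
  · obtain ⟨p, hp, hpb, hp𝔮⟩ := exists_prime_dvd_mem hb0 hb
    exact (key p hp hp𝔮).2 hpb

/-- **Every `r ∈ L^×` is `p^e` times a unit of `T_(p)`** (`e ∈ ℤ` is the `p`-adic valuation of
`r`; here only its existence: split off the `p`-part of numerator or denominator of a reduced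
fraction, Mathlib `FiniteMultiplicity.exists_eq_pow_mul_and_not_dvd`). [folklore] -/
theorem exists_zpow_mem_unitsAt {p : T} (hp : Prime p) {r : L} (hr : r ≠ 0) :
    haveI := (Ideal.span_singleton_prime hp.ne_zero).2 hp
    ∃ e : ℤ, r / algebraMap T L p ^ e ∈ unitsAt L (Ideal.span {p}) := by
  haveI := (Ideal.span_singleton_prime hp.ne_zero).2 hp
  have hinj := IsFractionRing.injective T L
  have hpL : algebraMap T L p ≠ 0 := fun h0 => hp.ne_zero ((map_eq_zero_iff _ hinj).1 h0)
  obtain ⟨a, b, hab, e⟩ := IsFractionRing.exists_reduced_fraction (A := T) r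
  have hb0 : (b : T) ≠ 0 := nonZeroDivisors.ne_zero b.2
  have ha0 : a ≠ 0 := by
    rintro rfl
    rw [IsLocalization.mk'_zero] at e
    exact hr e.symm
  have er : r = algebraMap T L a / algebraMap T L b := by
    rw [← e, IsFractionRing.mk'_eq_div]
  have hbL : algebraMap T L b ≠ 0 := fun h0 => hb0 ((map_eq_zero_iff _ hinj).1 h0)
  by_cases hpa : p ∣ a
  · -- `a = p^m a'`, `p ∤ a'`, and `p ∤ b`
    have hfin : FiniteMultiplicity p a := FiniteMultiplicity.of_not_isUnit hp.not_unit ha0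
    obtain ⟨a', ha', hpa'⟩ := hfin.exists_eq_pow_mul_and_not_dvd
    have hpb : ¬ p ∣ (b : T) := fun hpb => hp.not_unit (hab hpa hpb)
    have hX : algebraMap T L p ^ multiplicity p a ≠ 0 := pow_ne_zero _ hpL
    have eA : algebraMap T L a = algebraMap T L p ^ multiplicity p a * algebraMap T L a' := by
      conv_lhs => rw [ha']
      rw [map_mul, map_pow]
    refine ⟨multiplicity p a, a', b, ?_, ?_, ?_⟩
    · rwa [Ideal.mem_span_singleton]
    · rwa [Ideal.mem_span_singleton]
    · rw [er, zpow_natCast, eA, mul_div_assoc, mul_div_cancel_left₀ _ hX, div_mul_cancel₀ _ hbL]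
  · by_cases hpb : p ∣ (b : T)
    · have hfin : FiniteMultiplicity p (b : T) := FiniteMultiplicity.of_not_isUnit hp.not_unit hb0
      obtain ⟨b', hb', hpb'⟩ := hfin.exists_eq_pow_mul_and_not_dvd
      have eB : algebraMap T L b = algebraMap T L p ^ multiplicity p (b : T) * algebraMap T L b' := by
        conv_lhs => rw [hb']
        rw [map_mul, map_pow]
      refine ⟨-(multiplicity p (b : T) : ℤ), a, b', ?_, ?_, ?_⟩
      · rwa [Ideal.mem_span_singleton]
      · rwa [Ideal.mem_span_singleton]
      · rw [er, zpow_neg, zpow_natCast, div_inv_eq_mul, mul_assoc, ← eB, div_mul_cancel₀ _ hbL]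
    · refine ⟨0, a, b, ?_, ?_, ?_⟩
      · rwa [Ideal.mem_span_singleton]
      · rwa [Ideal.mem_span_singleton]
      · rw [zpow_zero, div_one, er, div_mul_cancel₀ _ hbL]

/-! ### Products of prime powers -/

omit [UniqueFactorizationMonoid T] in
/-- For a finite set `Q` of pairwise non-associated primes and exponents `c`, the product
`ψ = ∏_{q ∈ Q} q^{c q}` is `q₀^{c q₀}` times a unit of `T_(q₀)` for every `q₀ ∈ Q`. [folklore] -/
theorem prod_zpow_div_mem_unitsAt (Q : Finset T) (hQ : ∀ q ∈ Q, Prime q)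
    (hQ' : ∀ q ∈ Q, ∀ q' ∈ Q, Associated q q' → q = q') (c : T → ℤ) {q₀ : T} (hq₀ : q₀ ∈ Q) :
    haveI := (Ideal.span_singleton_prime (hQ q₀ hq₀).ne_zero).2 (hQ q₀ hq₀)
    (∏ q ∈ Q, algebraMap T L q ^ c q) / algebraMap T L q₀ ^ c q₀ ∈ unitsAt L (Ideal.span {q₀}) := by
  classical
  haveI := (Ideal.span_singleton_prime (hQ q₀ hq₀).ne_zero).2 (hQ q₀ hq₀)
  have hinj := IsFractionRing.injective T L
  have hq₀L : algebraMap T L q₀ ^ c q₀ ≠ 0 :=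
    zpow_ne_zero _ fun h0 => (hQ q₀ hq₀).ne_zero ((map_eq_zero_iff _ hinj).1 h0)
  rw [← Finset.mul_prod_erase Q _ hq₀, mul_div_right_comm, div_self hq₀L, one_mul]
  refine prod_mem fun q hq => ?_
  have hqQ : q ∈ Q := Finset.mem_of_mem_erase hq
  refine zpow_mem_unitsAt hinj (algebraMap_mem_unitsAt_span_of_not_associated (hQ q₀ hq₀) (hQ q hqQ)
    fun hass => ?_) _
  exact (Finset.ne_of_mem_erase hq) (hQ' q hqQ q₀ hq₀ hass.symm)

omit [UniqueFactorizationMonoid T] in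
/-- The product `∏_{q ∈ Q} q^{c q}` is a unit of `T_(ϖ)` for every prime `ϖ` associated to no
member of `Q`. [folklore] -/
theorem prod_zpow_mem_unitsAt_of_forall_not_associated (Q : Finset T) (hQ : ∀ q ∈ Q, Prime q)
    (c : T → ℤ) {ϖ : T} (hϖ : Prime ϖ) (h : ∀ q ∈ Q, ¬ Associated ϖ q) :
    haveI := (Ideal.span_singleton_prime hϖ.ne_zero).2 hϖ
    (∏ q ∈ Q, algebraMap T L q ^ c q) ∈ unitsAt L (Ideal.span {ϖ}) := by
  haveI := (Ideal.span_singleton_prime hϖ.ne_zero).2 hϖ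
  exact prod_mem fun q hq => zpow_mem_unitsAt (IsFractionRing.injective T L)
    (algebraMap_mem_unitsAt_span_of_not_associated hϖ (hQ q hq) (h q hq)) _

omit [IsFractionRing T L] in
/-- **The prime divisors of `a ≠ 0` as a finite set of pairwise non-associated primes**: a finite
`Q ⊆ T` of primes, pairwise non-associated, such that every prime dividing `a` is associated to
a member of `Q` (representatives of the classes of Mathlib's `UniqueFactorizationMonoid.factors a`).
[folklore] -/
theorem exists_finset_primes_of_ne_zero (a : T) (ha : a ≠ 0) :
    ∃ Q : Finset T, (∀ q ∈ Q, Prime q) ∧ (∀ q ∈ Q, ∀ q' ∈ Q, Associated q q' → q = q') ∧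
      ∀ p : T, Prime p → p ∣ a → ∃ q ∈ Q, Associated p q := by
  classical
  let rep : T → T := fun q => Quot.out (Associates.mk q)
  have hrep : ∀ q, Associated q (rep q) := fun q =>
    Associates.mk_eq_mk_iff_associated.1 (Associates.quot_out (Associates.mk q)).symm
  have hrep' : ∀ q q', Associated (rep q) (rep q') → rep q = rep q' := by
    intro q q' h
    have e : Associates.mk q = Associates.mk q' :=
      Associates.mk_eq_mk_iff_associated.2 (((hrep q).trans h).trans (hrep q').symm)
    simp only [rep, e]
  refine ⟨(UniqueFactorizationMonoid.factors a).toFinset.image rep, ?_, ?_, ?_⟩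
  · intro q hq
    obtain ⟨q', hq', rfl⟩ := Finset.mem_image.1 hq
    exact (hrep q').prime (UniqueFactorizationMonoid.prime_of_factor q' (Multiset.mem_toFinset.1 hq'))
  · intro q hq q' hq' hqq'
    obtain ⟨q₁, -, rfl⟩ := Finset.mem_image.1 hq
    obtain ⟨q₂, -, rfl⟩ := Finset.mem_image.1 hq'
    exact hrep' q₁ q₂ hqq'
  · intro p hp hpa
    obtain ⟨q, hq, hpq⟩ := UniqueFactorizationMonoid.exists_mem_factors_of_dvd ha hp.irreducible hpa
    exact ⟨rep q, Finset.mem_image.2 ⟨q, Multiset.mem_toFinset.2 hq, rfl⟩, hpq.trans (hrep q)⟩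

end UFD

/-! ### Prime elements of a polynomial ring over a factorial domain -/

namespace MvPolynomial

open _root_.MvPolynomial

variable {R : Type*} [CommRing R] [IsDomain R] [UniqueFactorizationMonoid R] {σ : Type*}

/-- **A prime element of `R[t₁, …, tₙ]` dividing a nonzero constant is associated to a prime
constant**: if `ϖ` is prime in `R[t]` (`R` factorial) and `ϖ ∣ C r`, `r ≠ 0`, then `ϖ ~ C π`
for a prime `π` of `R` (factor `r = ∏ π_j`; the `C π_j` are prime in `R[t]`, Mathlib
`MvPolynomial.prime_C_iff`, and `ϖ` divides one of them). [folklore] -/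
theorem exists_prime_associated_C_of_dvd_C {ϖ : MvPolynomial σ R} (hϖ : Prime ϖ) {r : R}
    (hr : r ≠ 0) (h : ϖ ∣ C r) : ∃ π : R, Prime π ∧ Associated ϖ (C π) := by
  classical
  obtain ⟨u, hu⟩ := UniqueFactorizationMonoid.factors_prod hr
  have h1 : ϖ ∣ ((UniqueFactorizationMonoid.factors r).map (C : R →+* MvPolynomial σ R)).prod := by
    have : (C r : MvPolynomial σ R) =
        ((UniqueFactorizationMonoid.factors r).map (C : R →+* MvPolynomial σ R)).prod * C (u : R) := by
      rw [← map_multiset_prod, ← map_mul, hu]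
    rw [this] at h
    exact (hϖ.dvd_or_dvd h).resolve_right fun hdu =>
      hϖ.not_unit (isUnit_of_dvd_unit hdu ((Units.map (C : R →+* MvPolynomial σ R).toMonoidHom u).isUnit))
  obtain ⟨q, hq, hϖq⟩ := hϖ.exists_mem_multiset_dvd h1
  obtain ⟨π, hπ, rfl⟩ := Multiset.mem_map.1 hq
  have hπp : Prime π := UniqueFactorizationMonoid.prime_of_factor π hπ
  exact ⟨π, hπp, hϖ.associated_of_dvd ((prime_C_iff (σ := σ)).2 hπp) hϖq⟩

/-- **Dichotomy for the primes of `R[t₁, …, tₙ]`** (`R` factorial): a prime element `ϖ` either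
generates an ideal meeting `R` only in `0` ("horizontal": `(ϖ) ∩ R = 0`) or is associated to a
prime constant `C π` ("vertical"). [folklore] -/
theorem comap_C_span_eq_bot_or {ϖ : MvPolynomial σ R} (hϖ : Prime ϖ) :
    (Ideal.span {ϖ}).comap (C : R →+* MvPolynomial σ R) = ⊥ ∨
      ∃ π : R, Prime π ∧ Associated ϖ (C π) := by
  classical
  by_cases h : (Ideal.span {ϖ}).comap (C : R →+* MvPolynomial σ R) = ⊥
  · exact Or.inl h
  · right
    obtain ⟨r, hr, hr0⟩ := Submodule.exists_mem_ne_zero_of_ne_bot h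
    rw [Ideal.mem_comap, Ideal.mem_span_singleton] at hr
    exact exists_prime_associated_C_of_dvd_C hϖ hr0 hr

omit [IsDomain R] [UniqueFactorizationMonoid R] in
/-- A vertical prime is not horizontal: `(C π) ∩ R = (π)` for `π ∈ R`. [folklore] -/
theorem comap_C_span_C {π : R} :
    (Ideal.span {(C π : MvPolynomial σ R)}).comap (C : R →+* MvPolynomial σ R) = Ideal.span {π} := by
  ext r
  rw [Ideal.mem_comap, Ideal.mem_span_singleton, Ideal.mem_span_singleton]
  constructor
  · rintro ⟨s, hs⟩
    refine ⟨MvPolynomial.coeff 0 s, ?_⟩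
    have := congrArg (MvPolynomial.coeff 0) hs
    rwa [coeff_zero_C, coeff_C_mul] at this
  · rintro ⟨s, rfl⟩
    exact ⟨C s, by rw [map_mul]⟩

end MvPolynomial

end Literature.RingTheory.UniqueFactorizationDomain
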